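import Mathlib.NumberTheory.Padics.PadicIntegers
import Literature.NumberTheory.EllipticCurves.FormalGroupShortModelParityProofs
import Literature.NumberTheory.EllipticCurves.FormalGroupChartUniquenessProofs
import HarnessLib

/-!
# Kummer-blindness criterion, part 1: coefficient algebra and the chart identity `κ·Q = X²`

Summit `BirchSwinnertonDyer`, route `ManinLocalTwoThree` (cell bsd-f2-manin), crux C2 `ManinOddAtFour` (stmt-BirchSwinnertonDyer-22967),
line `kato_shift_two`, v10 stub `stub_cuspidalKummerOddExponent` (E-an-53).  Helper algebra for the lead's theorem «E-an-53 holds at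
every datum with odd Manin constant» (files `…KummerBlindOfSquareOddManin`, `…CuspidalKummerOddExponentOfOddManin`):

* `two_dvd_and_sixteen_dvd_of_isSquare` — in `ℤ₂⟦t⟧`, if `P` is EVEN with `P(0) = 1`, `[t²]P = 0`, and
  `P² + ε t² P + γ t⁴` is a square, then `2 ∣ ε` and `16 ∣ ε² − 4γ` (coefficients of `t⁰, …, t⁸`);
* `formalXMulSq_sub_mul_quadratic_eq_sq` — on `y² = x³ + Ax + B` over `ℤ₂` with `ε³ + Aε + B = 0`:
  `(X − εt²)·(X² + εt²X + (ε² + A)t⁴) = X²` for `X = z²x(z)` (the chart equation, tree `formalXMulSq_sq_eq`);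
* `coeff_two_formalXMulSq_eq_zero` — `[t²]X = 0` when `a₁ = a₂ = a₃ = 0`.

Nothing about BSD or Manin's conjecture is proved here. [folklore algebra]
-/

set_option autoImplicit false
set_option linter.dupNamespace false

noncomputable section

open scoped Classical
open PowerSeries WeierstrassCurve Literature.NumberTheory.EllipticCurves
  Literature.RingTheory.FormalGroups

namespace Summit.BirchSwinnertonDyer.BirchSwinnertonDyer.Theorems.ManinLocalTwoThree

/-! ### §1 Coefficient algebra: `X² + εt²X + γt⁴ = G²` with `X` even, `x₀ = 1`, `x₂ = 0` forces `2 ∣ ε`, `16 ∣ ε² − 4γ` -/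

section Coeff

variable {R : Type*} [CommRing R]

/-- `[tⁿ](f·g) = Σ_{k ≤ n} [tᵏ]f · [tⁿ⁻ᵏ]g`. [folklore] -/
private theorem coeff_mul_sum_range (f g : R⟦X⟧) (n : ℕ) :
    coeff n (f * g) = ∑ k ∈ Finset.range (n + 1), coeff k f * coeff (n - k) g := by
  rw [coeff_mul, Finset.Nat.sum_antidiagonal_eq_sum_range_succ_mk]

/-- `[tⁿ](C a · tᵏ · f) = a · [tⁿ⁻ᵏ] f` for `k ≤ n`. [folklore] -/
private theorem coeff_C_mul_X_pow_mul_of_le (a : R) (f : R⟦X⟧) {k n : ℕ} (h : k ≤ n) :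
    coeff n (C a * X ^ k * f) = a * coeff (n - k) f := by
  rw [mul_assoc, coeff_C_mul, coeff_X_pow_mul', if_pos h]

/-- `[tⁿ](C a · tᵏ · f) = 0` for `n < k`. [folklore] -/
private theorem coeff_C_mul_X_pow_mul_of_lt (a : R) (f : R⟦X⟧) {k n : ℕ} (h : n < k) :
    coeff n (C a * X ^ k * f) = 0 := by
  rw [mul_assoc, coeff_C_mul, coeff_X_pow_mul', if_neg (not_le.mpr h), mul_zero]

end Coeff

section TwoAdic

/-- In `ℤ₂`: if `2 ∣ (u − v)(u + v)` then `2 ∣ u − v` (the residue field is `𝔽₂`, where `u + v = u − v`). [folklore] -/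
private theorem two_dvd_sub_of_two_dvd_mul_sub_add {u v : ℤ_[2]} (h : (2 : ℤ_[2]) ∣ (u - v) * (u + v)) :
    (2 : ℤ_[2]) ∣ u - v := by
  have hp : Prime (2 : ℤ_[2]) := by exact_mod_cast (PadicInt.prime_p (p := 2))
  rcases hp.dvd_or_dvd h with h1 | h1
  · exact h1
  · have : u - v = (u + v) - 2 * v := by ring
    rw [this]
    exact dvd_sub h1 (dvd_mul_right 2 v)

/-- The coefficients of `Q = P² + ε t² P + γ t⁴` in degree `n ≥ 2`. [folklore] -/
private theorem coeff_quadraticForm_of_two_le (P : ℤ_[2]⟦X⟧) (ε γ : ℤ_[2]) {n : ℕ} (hn : 2 ≤ n) :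
    coeff n (P ^ 2 + C ε * X ^ 2 * P + C γ * X ^ 4) =
      (∑ k ∈ Finset.range (n + 1), coeff k P * coeff (n - k) P) + ε * coeff (n - 2) P +
        (if n = 4 then γ else 0) := by
  rw [map_add, map_add, sq, coeff_mul_sum_range, coeff_C_mul_X_pow_mul_of_le _ _ hn, coeff_C_mul_X_pow]

/-- The coefficients of `Q = P² + ε t² P + γ t⁴` in degree `n < 2`. [folklore] -/
private theorem coeff_quadraticForm_of_lt_two (P : ℤ_[2]⟦X⟧) (ε γ : ℤ_[2]) {n : ℕ} (hn : n < 2) :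
    coeff n (P ^ 2 + C ε * X ^ 2 * P + C γ * X ^ 4) =
      ∑ k ∈ Finset.range (n + 1), coeff k P * coeff (n - k) P := by
  rw [map_add, map_add, sq, coeff_mul_sum_range, coeff_C_mul_X_pow_mul_of_lt _ _ hn, coeff_C_mul_X_pow,
    if_neg (by omega), add_zero, add_zero]

/-- **The coefficient lemma.**  Let `P ∈ ℤ₂⟦t⟧` be EVEN with `P(0) = 1` and vanishing `t²`-coefficient, and
`ε, γ ∈ ℤ₂`.  If `P² + ε t² P + γ t⁴` is a square in `ℤ₂⟦t⟧` then `2 ∣ ε` and `16 ∣ ε² − 4γ`.  (Compare the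
coefficients of `t⁰, …, t⁸`: with `G = ±(1 + g₂t² + g₄t⁴ + ⋯)`, odd `gᵢ` vanish, `ε = 2g₂`, `γ = 2g₄ + g₂² − 2x₄`,
and `g₄² ≡ x₄² (mod 2)` from `t⁸`, so `g₄ ≡ x₄` and `ε² − 4γ = 8(x₄ − g₄) ≡ 0 (mod 16)`.) [folklore] -/
theorem two_dvd_and_sixteen_dvd_of_isSquare {P : ℤ_[2]⟦X⟧} (h0 : coeff 0 P = 1) (h2 : coeff 2 P = 0)
    (hodd : ∀ n, Odd n → coeff n P = 0) (ε γ : ℤ_[2])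
    (hsq : IsSquare (P ^ 2 + C ε * X ^ 2 * P + C γ * X ^ 4)) :
    (2 : ℤ_[2]) ∣ ε ∧ (16 : ℤ_[2]) ∣ ε ^ 2 - 4 * γ := by
  obtain ⟨G₀, hG₀⟩ := hsq
  have x1 : coeff 1 P = 0 := hodd 1 odd_one
  have x3 : coeff 3 P = 0 := hodd 3 (by decide)
  have x5 : coeff 5 P = 0 := hodd 5 (by decide)
  have x7 : coeff 7 P = 0 := hodd 7 (by decide)
  -- normalise the sign of `G`: `G(0) = ±1`
  have hg0sq : coeff 0 G₀ * coeff 0 G₀ = 1 := by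
    have h := congrArg (coeff 0) hG₀
    rw [coeff_quadraticForm_of_lt_two _ _ _ (by norm_num : 0 < 2), coeff_mul_sum_range] at h
    simp only [zero_add, Finset.sum_range_one, Nat.sub_zero, h0, mul_one] at h
    exact h.symm
  obtain ⟨G, hG, hg0⟩ : ∃ G : ℤ_[2]⟦X⟧, P ^ 2 + C ε * X ^ 2 * P + C γ * X ^ 4 = G * G ∧ coeff 0 G = 1 := by
    rcases mul_self_eq_one_iff.mp hg0sq with h1 | h1
    · exact ⟨G₀, hG₀, h1⟩
    · exact ⟨-G₀, by rw [hG₀]; ring, by rw [map_neg, h1, neg_neg]⟩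
  -- the coefficient identities in degrees 1, 2, 3, 4, 5, 7, 8
  have hQG : ∀ n, 2 ≤ n → (∑ k ∈ Finset.range (n + 1), coeff k P * coeff (n - k) P) + ε * coeff (n - 2) P +
      (if n = 4 then γ else 0) = ∑ k ∈ Finset.range (n + 1), coeff k G * coeff (n - k) G := fun n hn => by
    rw [← coeff_quadraticForm_of_two_le P ε γ hn, hG, coeff_mul_sum_range]
  have e1 : ∑ k ∈ Finset.range 2, coeff k P * coeff (1 - k) P = ∑ k ∈ Finset.range 2, coeff k G * coeff (1 - k) G := by
    rw [← coeff_quadraticForm_of_lt_two P ε γ (by norm_num : 1 < 2), hG, coeff_mul_sum_range]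
  have e2 := hQG 2 (by norm_num)
  have e3 := hQG 3 (by norm_num)
  have e4 := hQG 4 (by norm_num)
  have e5 := hQG 5 (by norm_num)
  have e7 := hQG 7 (by norm_num)
  have e8 := hQG 8 (by norm_num)
  simp only [Finset.sum_range_succ, Finset.sum_range_zero, zero_add, Nat.sub_self, Nat.reduceSub, Nat.sub_zero,
    h0, h2, x1, x3, x5, x7, hg0, mul_one, one_mul, mul_zero, zero_mul, add_zero, if_true, if_false,
    show (2 : ℕ) ≠ 4 by decide, show (3 : ℕ) ≠ 4 by decide, show (5 : ℕ) ≠ 4 by decide, show (7 : ℕ) ≠ 4 by decide,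
    show (8 : ℕ) ≠ 4 by decide] at e1 e2 e3 e4 e5 e7 e8
  -- odd coefficients of `G` vanish
  have hnz : ∀ {u : ℤ_[2]}, 2 * u = 0 → u = 0 := fun {u} hu => by
    rcases mul_eq_zero.mp hu with h | h
    · exact absurd h two_ne_zero
    · exact h
  have g1 : coeff 1 G = 0 := hnz (by linear_combination -e1)
  have g3 : coeff 3 G = 0 := hnz (by rw [g1] at e3; linear_combination -e3)
  have g5 : coeff 5 G = 0 := hnz (by rw [g1, g3] at e5; linear_combination -e5)
  have g7 : coeff 7 G = 0 := hnz (by rw [g1, g3, g5] at e7; linear_combination -e7)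
  rw [g1] at e2
  rw [g1, g3] at e4
  rw [g1, g3, g5, g7] at e8
  -- `ε = 2 g₂`
  have hε : ε = 2 * coeff 2 G := by linear_combination e2
  refine ⟨⟨coeff 2 G, hε⟩, ?_⟩
  -- `ε² − 4γ = 8 (x₄ − g₄)` and `g₄ ≡ x₄ (mod 2)` from the `t⁸` identity
  have hγ : ε ^ 2 - 4 * γ = 8 * (coeff 4 P - coeff 4 G) := by
    rw [hε]; linear_combination (-4 : ℤ_[2]) * e4
  have h8 : (2 : ℤ_[2]) ∣ (coeff 4 P - coeff 4 G) * (coeff 4 P + coeff 4 G) := by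
    refine ⟨coeff 8 G + coeff 2 G * coeff 6 G - coeff 8 P - coeff 2 G * coeff 6 P, ?_⟩
    rw [hε] at e8
    linear_combination e8
  obtain ⟨m, hm⟩ := two_dvd_sub_of_two_dvd_mul_sub_add h8
  exact ⟨m, by rw [hγ, hm]; ring⟩

end TwoAdic

/-! ### §2 The chart identity `κ·Q = X²` on a short `2`-integral model -/

section Chart

variable (V : WeierstrassCurve ℤ_[2])

/-- **`κ · Q = X²`.**  On `y² = x³ + A x + B` (`a₁ = a₂ = a₃ = 0`) with `ε³ + Aε + B = 0`, the cleared
`x`-expansion `X = z²x(z)` satisfies `(X − εz²)·(X² + εz²X + (ε² + A)z⁴) = X²` — the chart equation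
`X² = X³ + A z⁴ X + B z⁶` (tree `formalXMulSq_sq_eq`) rearranged; it is `x²(x − ε)(x² + εx + ε² + A) = x²y²` in
disguise. [folklore] -/
theorem formalXMulSq_sub_mul_quadratic_eq_sq (h₁ : V.a₁ = 0) (h₂ : V.a₂ = 0) (h₃ : V.a₃ = 0) {ε : ℤ_[2]}
    (hε : ε ^ 3 + V.a₄ * ε + V.a₆ = 0) :
    (V.formalXMulSq - C ε * X ^ 2) *
        (V.formalXMulSq ^ 2 + C ε * X ^ 2 * V.formalXMulSq + C (ε ^ 2 + V.a₄) * X ^ 4) =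
      V.formalXMulSq ^ 2 := by
  have hchart := V.formalXMulSq_sq_eq
  rw [h₁, h₂, h₃] at hchart
  simp only [map_zero, zero_mul, add_zero] at hchart
  have hB : C V.a₆ = -(C ε ^ 3 + C V.a₄ * C ε : ℤ_[2]⟦X⟧) := by
    rw [← map_pow, ← map_mul, ← map_add, ← map_neg]
    congr 1
    linear_combination hε
  rw [map_add, map_pow] at *
  linear_combination (-1 : ℤ_[2]⟦X⟧) * hchart - X ^ 6 * hB

/-- The `t²`-coefficient of `X = z²x(z)` vanishes when `a₁ = a₂ = a₃ = 0` (from the chart equation in degree `2`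
and the vanishing of the odd coefficient `x₁`). [folklore] -/
theorem coeff_two_formalXMulSq_eq_zero (h₁ : V.a₁ = 0) (h₂ : V.a₂ = 0) (h₃ : V.a₃ = 0) :
    coeff 2 V.formalXMulSq = 0 := by
  haveI : V.IsCharNeTwoNF := ⟨h₁, h₃⟩
  have x0 : coeff 0 V.formalXMulSq = 1 := by
    rw [coeff_zero_eq_constantCoeff]; exact V.constantCoeff_formalXMulSq
  have x1 : coeff 1 V.formalXMulSq = 0 := V.coeff_formalXMulSq_eq_zero_of_odd odd_one
  have hchart := congrArg (coeff 2) V.formalXMulSq_sq_eq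
  rw [h₁, h₂, h₃] at hchart
  simp only [map_zero, zero_mul, add_zero, map_add] at hchart
  rw [coeff_C_mul_X_pow_mul_of_lt _ _ (by norm_num : 2 < 4), coeff_C_mul_X_pow, if_neg (by norm_num), add_zero,
    add_zero, show V.formalXMulSq ^ 3 = V.formalXMulSq * (V.formalXMulSq * V.formalXMulSq) by ring,
    show V.formalXMulSq ^ 2 = V.formalXMulSq * V.formalXMulSq by ring] at hchart
  simp only [coeff_mul_sum_range, Finset.sum_range_succ, Finset.sum_range_zero, zero_add, Nat.sub_self,
    Nat.reduceSub, Nat.sub_zero, x0, x1, mul_one, one_mul, mul_zero, add_zero] at hchart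
  linear_combination -hchart

end Chart

end Summit.BirchSwinnertonDyer.BirchSwinnertonDyer.Theorems.ManinLocalTwoThree

end
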